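import Summits.AtomisticToContinuum.FouriersLaw.Theses.CoercivePulse
import Summits.AtomisticToContinuum.FouriersLaw.Theorems.HoelderEscapeProfileAbelSpreadCeilingOfUniformAbelianRegularity
import HarnessLib

/-!
# Stub `stub_abelMeanCeiling` of line `SpikeLemma`, crux `CoercivePulse.LinearCeiling`
(item stmt-AtomisticToContinuum-15383; `--supports` file, closes nothing)

WHAT. Registered stub 2 of the skeleton of the crux `CoercivePulse.LinearCeiling` (linear upper envelope of the Helfand
moment of the energy pulse of the pinned anharmonic chain): the route's own (R) =
`CoercivePulse.UniformAbelianRegularity` (item stmt-AtomisticToContinuum-13416) implies that for EVERY guarded pair `(μ, D)`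
of `pinnedChain ω₂ lam β γ` at temperature `T` (a shift- and reversal-invariant DLR state `μ` and a `μ`-preserving
infinite-volume dynamics `D`) the Abel means `Â(ν) = ∫₀^∞ e^{−νt} C_T(t) dt` of the summed current autocorrelation are
bounded above for `ν ∈ (0, ν₀)`.

HOW (every ingredient is a landed theorem; this is the first half of the sibling
`AbelSpreadCeiling.RegularityCollapse.abelSpreadCeiling_of_uniformAbelianRegularity`, without the Helfand step).
(1) the canonical Buttà–Marchioro twin `D'` of `D` (`RegularityCollapse.stub_canonicalTwin`: carrier `bmGood`, preserves
`μ`, absolutely convergent correlations, same `C_T`), transported to bath constant `1` (the infinite-volume objects do not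
see `γ`); (2) DLR uniqueness + superstability + the fixed-frequency matching `F_N(ν)/N → Â(ν)`
(`LoomisCompactHorizonWitness.stub_regularDLRUnique`, `stub_fixedFrequencyMatching`); (3) the open chain at bath constant
`1`: `nessUnique_proof`, `exists_steadyFamily_response`, integrability of `c_N` from `Corrector.openChainGreenKubo_holds` +
`integral_totalBondCurrent_gibbsMeasure`; (4) (R) at `ε = 1` and the pure real-analysis `abel_bound_of_regularity` at
`ν₁ = ν₀/2`: `Â(ν) ≤ |Â(ν₁)| + 3` for `ν < ν₀`, passing to the limit `N → ∞` in `F_N(ν)/N ≤ |Â(ν₁)| + 3`.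
-/

noncomputable section

namespace Summit.AtomisticToContinuum.FouriersLaw.Theorems.LinearCeiling.SpikeLemma

open MeasureTheory Filter Set
open scoped Topology BigOperators
open Literature.MathematicalPhysics.KineticTheory.HeatConduction

/-- **Stub `stub_abelMeanCeiling` (registered signature, verbatim) — (R) ⇒ Abel-mean ceiling of `C_T` for every
guarded pair.** For the pinned anharmonic chain, N-uniform Abelian regularity of the open chain's equilibrium current
autocorrelation (`CoercivePulse.UniformAbelianRegularity`, item stmt-AtomisticToContinuum-13416) implies that the Abel
means `∫₀^∞ e^{−νt} C_T(t) dt` of the summed current autocorrelation of every guarded pair `(μ, D)` are bounded above by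
one constant for all `ν ∈ (0, ν₀)` (canonical twin at bath constant `1`, fixed-frequency open/closed matching, the
open-chain Green–Kubo identity, `abel_bound_of_regularity`). [folklore] -/
theorem stub_abelMeanCeiling :
    _root_.Summit.AtomisticToContinuum.FouriersLaw.Theses.CoercivePulse.UniformAbelianRegularity → ∀ ω₂ lam β γ : ℝ, 0 < ω₂ → 0 < lam → 0 < β → ∀ T : ℝ, 0 < T → ∀ μ : MeasureTheory.Measure Literature.MathematicalPhysics.KineticTheory.HeatConduction.ChainConfig, (Literature.MathematicalPhysics.KineticTheory.HeatConduction.pinnedChain ω₂ lam β γ).IsChainGibbsMeasure T μ → Literature.MathematicalPhysics.KineticTheory.HeatConduction.IsShiftInvariant μ → μ.map (fun σ : Literature.MathematicalPhysics.KineticTheory.HeatConduction.ChainConfig => fun x : ℤ => ((σ x).1, -(σ x).2)) = μ → ∀ D : Literature.MathematicalPhysics.KineticTheory.HeatConduction.InfiniteChainDynamics (Literature.MathematicalPhysics.KineticTheory.HeatConduction.pinnedChain ω₂ lam β γ), D.PreservesMeasure μ → ∃ B ν₀ : ℝ, 0 < ν₀ ∧ ∀ ν : ℝ, 0 < ν →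 ν < ν₀ → ∫ t in Set.Ioi (0:ℝ), Real.exp (-(ν * t)) * D.currentCorrelation μ t ≤ B := by
  intro hRstub ω₂ lam β γ hω hl hβ T hT μ hG hSI hR D hP
  -- the canonical BM twin, transported to bath constant 1 (same carrier, flow and fields), and the landed matching
  obtain ⟨D', hcar, -, -, hP', -, hAC', hCC⟩ :=
    Summit.AtomisticToContinuum.FouriersLaw.Theorems.AbelSpreadCeiling.RegularityCollapse.stub_canonicalTwin
      ω₂ lam β γ hω hl hβ T hT μ hG hSI hR D hP
  let D₁ : InfiniteChainDynamics (pinnedChain ω₂ lam β 1) :=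
    ⟨D'.carrier, D'.flow, D'.mapsTo, D'.flow_zero, D'.isSolution, D'.unique⟩
  have hG₁ : (pinnedChain ω₂ lam β 1).IsChainGibbsMeasure T μ := hG
  have hSS₁ : (pinnedChain ω₂ lam β 1).HasSuperstabilityEstimate μ :=
    OscillatorChain.hasSuperstabilityEstimate_of_isShiftInvariant_pinnedChain 1 hω hl.le hβ.le hT hG₁ hSI
  have hcar₁ : D₁.carrier ⊆ (pinnedChain ω₂ lam β 1).bmGood := subset_of_eq hcar
  have hPres₁ : D₁.PreservesMeasure μ := hP'
  have hAC₁ : ∀ t : ℝ, D₁.HasAbsConvergentCorrelation μ t := hAC'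
  have hUniq :=
    Summit.AtomisticToContinuum.FouriersLaw.Theorems.AbelThermodynamicLimit.LoomisCompactHorizonWitness.stub_regularDLRUnique
      ω₂ lam β 1 hω hl hβ one_pos T hT
  have hMatch :=
    Summit.AtomisticToContinuum.FouriersLaw.Theorems.AbelThermodynamicLimit.LoomisCompactHorizonWitness.stub_fixedFrequencyMatching
      ω₂ lam β 1 hω hl hβ one_pos T hT hUniq μ D₁ hG₁ hSI hSS₁ hcar₁ hPres₁ hAC₁
  have hcc : ∀ t : ℝ, D₁.currentCorrelation μ t = D.currentCorrelation μ t := fun t => by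
    rw [← hCC t]; rfl
  -- the open chain at bath constant 1: uniqueness, a steady family, integrability of c_N (landed KDN identity)
  have hUq := Summit.AtomisticToContinuum.FouriersLaw.Theorems.nessUnique_proof ω₂ lam β 1 hω hl hβ one_pos
  obtain ⟨μc, -, hμc, -⟩ :=
    Summit.AtomisticToContinuum.FouriersLaw.Theorems.AbelThermodynamicLimit.LoomisCompactHorizonWitness.exists_steadyFamily_response
      ω₂ lam β 1 hω hl hβ one_pos hUq T hT
  let c : ℕ → ℝ → ℝ := fun N t => ∫ z, (∑ i : Fin N, (pinnedChain ω₂ lam β 1).bondCurrent N i z) *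
      (∫ y, (∑ i : Fin N, (pinnedChain ω₂ lam β 1).bondCurrent N i y)
        ∂((pinnedChain ω₂ lam β 1).transitionKernel N T T t.toNNReal z)) ∂((pinnedChain ω₂ lam β 1).gibbsMeasure N T)
  have hint : ∀ᶠ N : ℕ in atTop, IntegrableOn (c N) (Ioi 0) := by
    rw [eventually_atTop]
    refine ⟨2, fun N hN2 => ?_⟩
    have hGK := Summit.AtomisticToContinuum.FouriersLaw.Theorems.OddSectorIrreversibility.Corrector.openChainGreenKubo_holds
      ω₂ lam β 1 hω hl hβ one_pos hUq μc hμc T hT N hN2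
    have hm0 :=
      Summit.AtomisticToContinuum.FouriersLaw.Theorems.OddSectorIrreversibility.Corrector.integral_totalBondCurrent_gibbsMeasure
        ω₂ lam β 1 N T
    dsimp only at hGK
    rw [hm0, mul_zero] at hGK
    simp only [sub_zero] at hGK
    exact hGK.1
  -- (R) at bath constant 1 with ε = 1
  obtain ⟨ν₀, hν₀, hRν⟩ := hRstub ω₂ lam β 1 hω hl hβ one_pos T hT 1 one_pos
  have hRev : ∀ ν : ℝ, 0 < ν → ν < ν₀ → ∀ᶠ N : ℕ in atTop,
      |∫ t in Ioi (0:ℝ), (1 - Real.exp (-(ν * t))) * c N t| ≤ 1 * N := by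
    intro ν hν hν'
    obtain ⟨N₀, hN₀⟩ := hRν ν hν hν'
    rw [eventually_atTop]
    exact ⟨N₀, fun N hN => hN₀ N hN⟩
  -- the collapse: Â(ν) ≤ |Â(ν₁)| + 3 for ν < ν₀, ν₁ = ν₀/2
  have hν₁ : 0 < ν₀ / 2 := by positivity
  have hν₁' : ν₀ / 2 < ν₀ := by linarith
  have hkey :=
    Summit.AtomisticToContinuum.FouriersLaw.Theorems.AbelSpreadCeiling.RegularityCollapse.abel_bound_of_regularity
      c hint hRev hν₁ hν₁' (hMatch (ν₀ / 2) hν₁)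
  refine ⟨|MeasureTheory.integral (MeasureTheory.volume.restrict (Set.Ioi (0:ℝ)))
      (fun t : ℝ => Real.exp (-(ν₀ / 2 * t)) * D₁.currentCorrelation μ t)| + 3, ν₀, hν₀, fun ν hν hνlt => ?_⟩
  have hle : MeasureTheory.integral (MeasureTheory.volume.restrict (Set.Ioi (0:ℝ)))
      (fun t : ℝ => Real.exp (-(ν * t)) * D₁.currentCorrelation μ t) ≤
      |MeasureTheory.integral (MeasureTheory.volume.restrict (Set.Ioi (0:ℝ)))
        (fun t : ℝ => Real.exp (-(ν₀ / 2 * t)) * D₁.currentCorrelation μ t)| + 3 :=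
    le_of_tendsto (hMatch ν hν) (hkey ν hν hνlt)
  simpa only [hcc] using hle

end Summit.AtomisticToContinuum.FouriersLaw.Theorems.LinearCeiling.SpikeLemma

end
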